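import Summits.QuantumFields.YangMills.Theorems.BalabanUVNodesN15CovariantLandauFlatBackGradRowsKing
import HarnessLib

/-!
# Route «BalabanUVNodes», node N15 = NE2, road (c) — ALL TWELVE FLAT KERNEL ROWS OF THE LANDAU LETTER's PRIMITIVE FAMILY AT ONE CONSTANT BLOCK: the one-grid rows of `G′(1)`, `∂G′(1)`,
# `G′(1)∂ᵀ`, `S̄ₕ∂G′(1)` on the coarse run `L^K` and on the fine run `L^nL^K`, and the four two-grid η-defect rows through King's pairing — HYPOTHESIS-FREE on King's torus family
# at the paired couplings, ONE `(C, δ, γ)` for every `K, n`, volume and colour type (dag-n15-a g34, (Ξ-4): the knit-ready package of n15-c∕220 + (Ξ-1)–(Ξ-3))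

Cell `pub-ymgap`, seat `pub-ymgap-dag-n15-a` (generation g34; KNIT-BY-NAME lane; HUMAN RULING D-0062; chair R424 venue).  `bears_on: R4∕N15 · K3⁸ SpineGivenEndpointR13SepCoPHV
(stmt-QuantumFields-27366)`; filed `--supports stmt-QuantumFields-27366 --as helper` — COUNT-NEUTRAL.  One theorem; 0 `sorry`.  Imports BY NAME (Ξ-3) `…CovariantLandauFlatBackGradRowsKing`
(`flatKernelRow_gradBack_king`, `flatTwoGridRow_gradBack_king`; through it (Ξ-1) `flatTwoGridKernelRows_king`, n15-c∕220 `flatKernelRows_king`, n15-c∕237 `bBack`).  Nothing in the tree is modified;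
no estimate is proved here — bookkeeping (`max` of constants, `min` of rates, `HasMaj.mono`).

WHY.  dag-n15-c g24's (G3) road displays its flat analytic input per grid pair as SEPARATE rows (n15-c∕236 `hG1′ hA1′ hDG hDA`, 237 `hD1 hD1b hD1′ hD1b′ hDD hDDb`, 238–239 …) at ONE decay rate `δ`
(tied to `RowSum (unitTorusGeo L k M) s c`, `3s ≤ δ`); the node edition 234′ will quantify them per index of the glued family.  The knit of the CLOSED road-(c) literal ((♭-8b)
`exists_live_and_n15At_sfObjects₈qvr_of_defectRow` ∘ 234′) wants every flat row at the SAME `(C, δ)` and the two-grid rows at one rate exponent: THIS FILE is that package, once.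
* ★★★ `flatRowsAll_king` — for odd `L ≥ 3`, `a₀ > 0`, `0 < γ < 1∕2`: `∃ C δ > 0 ∀ K ≥ 1 ∀ n ≥ 1 ∀ e (M = 2L^e) ∀ ι`, in the geometry `unitTorusGeo L K M` (label = the coarse level, as n15-c∕236–237):
  rows 1–4 = coarse one-grid `G′(1)`, `∂G′(1)`, `G′(1)∂ᵀ`, `S̄ₕ∂G′(1)` at `a_K·(L^K)^{d+1}` (`C·e^{−δd}`); rows 5–8 = the same on the fine run at `a_{n+K}·(L^nL^K)^{d+1}`; rows 9–12 = the two-grid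
  η-defects of the four kernels through `P̂_S = pull ∘ liftMap (kingPr L K n M)`, `P̂_V = pull ∘ liftMap (kingPrV L K n M)` (`C·(L^K)^{−γ}·e^{−δd}`).

HONEST FRAMING ∕ LIMITS.  King's `A = 0` MODEL statements (dag-n15-e's rung, kernel-checked; n15-c∕220) read at `m² = 0` on Bałaban's flat objects at `U ≡ 1`; periodic b.c., `K, n ≥ 1`, tori `2L^e`,
odd `L ≥ 3`, `0 < γ < 1∕2`, King's PAIRED couplings `a_K`, `a_{n+K}` (`0 < a_· ≤ a₀`); NOT [Balaban1985BackgroundPropagators] Thm 3.1 as printed; NE2⁺ NOT PRINTED; N15 of record untouched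
(DISCHARGED AS CONSUMED, p687738); counts UNMOVED (typed 28∕28 · discharged 8∕27); one finite 𝕋⁴ at fixed ε per index — NOT infinite volume ∕ OS ∕ mass gap ∕ Clay.  Restate-immune (no Theses
import).  No `sorry`, `instance`, `notation`; standard axioms.
-/

noncomputable section

open scoped BigOperators Matrix Kronecker

namespace Summit.QuantumFields.YangMills.BalabanUVNodes.N15.CovLandau

open Literature.MathematicalPhysics.QuantumFieldTheory.Balaban1983to89
open Literature.MathematicalPhysics.QuantumFieldTheory.Balaban1983to89.B5Prop11Plancherel (Tor fine unitVec)
open Literature.MathematicalPhysics.QuantumFieldTheory.Balaban1983to89.B11SectG (BlockNorm HasMaj)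
open Literature.MathematicalPhysics.QuantumFieldTheory.Balaban1983to89.B6UnitTorusCarrier (unitTorusGeo)
open Literature.MathematicalPhysics.QuantumFieldTheory.Balaban1983to89.T4EtaRateDefect (idef)
open Literature.MathematicalPhysics.QuantumFieldTheory.Balaban1983to89.T4EtaRateCoeffDefect (pull)
open Literature.MathematicalPhysics.QuantumFieldTheory.King1986 (aK aK_pos aK_le)
open Literature.MathematicalPhysics.QuantumFieldTheory.King1986.Torus (blockOf tdistT tdistT_nonneg fineOp)
open Summit.QuantumFields.YangMills.BalabanUVNodes.N15.VectorPiece (kingPr kingPrV)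
open Summit.QuantumFields.YangMills.BalabanUVNodes.N15.MatrixSpecies (liftBlk liftMap)

variable {d : ℕ} (L : ℕ) [NeZero L]

/-- ★★★ **ALL TWELVE FLAT KERNEL ROWS AT ONE CONSTANT BLOCK, HYPOTHESIS-FREE ON KING's TORUS FAMILY** (coarse one-grid ×4, fine one-grid ×4, two-grid ×4; see the module docstring for the list).
[cite: King1986, Thm 3.3 p.655, (3.7)–(3.8) p.656, Prop. 3.8 (3.71) p.664, Prop. 3.9 (3.73) p.665, p.664 («x′ ∈ B^n(x)»), (4.5) p.670; Balaban1983RegularityDecay, Theorem (1.9)–(1.10) p.573; Balaban1985BackgroundPropagators, Thm 3.1 (3.42)–(3.43) pp.397–398, (3.64) p.402 (shapes at `U ≡ 1`)] -/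
theorem flatRowsAll_king (hLodd : Odd L) (hL : 2 ≤ L) {a₀ : ℝ} (ha₀ : 0 < a₀) {γ : ℝ} (hγ0 : 0 < γ) (hγ1 : γ < 1 / 2) :
    ∃ C δ : ℝ, 0 < C ∧ 0 < δ ∧ ∀ (K : ℕ), 1 ≤ K → ∀ (n : ℕ), 1 ≤ n → ∀ (e : ℕ) (M : Fin (d + 1) → ℕ) [∀ μ, NeZero (M μ)], (∀ μ, M μ = 2 * L ^ e) →
      ∀ (ι : Type) [Fintype ι] [DecidableEq ι],
        HasMaj (BlockNorm.ofBlocks (unitTorusGeo L K M) (liftBlk (blockOf (L ^ K) M) ι)) (BlockNorm.ofBlocks (unitTorusGeo L K M) (liftBlk (blockOf (L ^ K) M) ι)) (Matrix.mulVecLin (cGreen M (L ^ K) (fun (_ : Fin (d + 1)) (_ : Tor (fine (L ^ K) M)) => (1 : Matrix ι ι ℝ)) (aK a₀ (L : ℝ) K * (((L ^ K) : ℕ) : ℝ) ^ (d + 1)))) (fun y y' => C * Real.exp (-(δ * tdistT M y y'))) ∧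
        HasMaj (BlockNorm.ofBlocks (unitTorusGeo L K M) (liftBlk (blockOf (L ^ K) M) ι)) (BlockNorm.ofBlocks (unitTorusGeo L K M) (liftBlk (fun b : Tor (fine (L ^ K) M) × Fin (d + 1) => blockOf (L ^ K) M b.1) ι)) (Matrix.mulVecLin (cgrad M (L ^ K) (fun (_ : Fin (d + 1)) (_ : Tor (fine (L ^ K) M)) => (1 : Matrix ι ι ℝ)) * cGreen M (L ^ K) (fun (_ : Fin (d + 1)) (_ : Tor (fine (L ^ K) M)) => (1 : Matrix ι ι ℝ)) (aK a₀ (L : ℝ) K * (((L ^ K) : ℕ) : ℝ) ^ (d + 1)))) (fun y y' => C * Real.exp (-(δ * tdistT M y y'))) ∧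
        HasMaj (BlockNorm.ofBlocks (unitTorusGeo L K M) (liftBlk (fun b : Tor (fine (L ^ K) M) × Fin (d + 1) => blockOf (L ^ K) M b.1) ι)) (BlockNorm.ofBlocks (unitTorusGeo L K M) (liftBlk (blockOf (L ^ K) M) ι)) (Matrix.mulVecLin (cGreen M (L ^ K) (fun (_ : Fin (d + 1)) (_ : Tor (fine (L ^ K) M)) => (1 : Matrix ι ι ℝ)) (aK a₀ (L : ℝ) K * (((L ^ K) : ℕ) : ℝ) ^ (d + 1)) * (cgrad M (L ^ K) (fun (_ : Fin (d + 1)) (_ : Tor (fine (L ^ K) M)) => (1 : Matrix ι ι ℝ)))ᵀ)) (fun y y' => C * Real.exp (-(δ * tdistT M y y'))) ∧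
        HasMaj (BlockNorm.ofBlocks (unitTorusGeo L K M) (liftBlk (blockOf (L ^ K) M) ι)) (BlockNorm.ofBlocks (unitTorusGeo L K M) (liftBlk (fun b : Tor (fine (L ^ K) M) × Fin (d + 1) => blockOf (L ^ K) M b.1) ι)) (Matrix.mulVecLin ((bBack M (L ^ K) (ι := ι)) * ((cgrad M (L ^ K) (fun (_ : Fin (d + 1)) (_ : Tor (fine (L ^ K) M)) => (1 : Matrix ι ι ℝ))) * (cGreen M (L ^ K) (fun (_ : Fin (d + 1)) (_ : Tor (fine (L ^ K) M)) => (1 : Matrix ι ι ℝ)) (aK a₀ (L : ℝ) K * (((L ^ K) : ℕ) : ℝ) ^ (d + 1)))))) (fun y y' => C * Real.exp (-(δ * tdistT M y y'))) ∧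
        HasMaj (BlockNorm.ofBlocks (unitTorusGeo L K M) (liftBlk (blockOf (L ^ n * L ^ K) M) ι)) (BlockNorm.ofBlocks (unitTorusGeo L K M) (liftBlk (blockOf (L ^ n * L ^ K) M) ι)) (Matrix.mulVecLin (cGreen M (L ^ n * L ^ K) (fun (_ : Fin (d + 1)) (_ : Tor (fine (L ^ n * L ^ K) M)) => (1 : Matrix ι ι ℝ)) (aK a₀ (L : ℝ) (n + K) * (((L ^ n * L ^ K) : ℕ) : ℝ) ^ (d + 1)))) (fun y y' => C * Real.exp (-(δ * tdistT M y y'))) ∧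
        HasMaj (BlockNorm.ofBlocks (unitTorusGeo L K M) (liftBlk (blockOf (L ^ n * L ^ K) M) ι)) (BlockNorm.ofBlocks (unitTorusGeo L K M) (liftBlk (fun b : Tor (fine (L ^ n * L ^ K) M) × Fin (d + 1) => blockOf (L ^ n * L ^ K) M b.1) ι)) (Matrix.mulVecLin (cgrad M (L ^ n * L ^ K) (fun (_ : Fin (d + 1)) (_ : Tor (fine (L ^ n * L ^ K) M)) => (1 : Matrix ι ι ℝ)) * cGreen M (L ^ n * L ^ K) (fun (_ : Fin (d + 1)) (_ : Tor (fine (L ^ n * L ^ K) M)) => (1 : Matrix ι ι ℝ)) (aK a₀ (L : ℝ) (n + K) * (((L ^ n * L ^ K) : ℕ) : ℝ) ^ (d + 1)))) (fun y y' => C * Real.exp (-(δ * tdistT M y y'))) ∧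
        HasMaj (BlockNorm.ofBlocks (unitTorusGeo L K M) (liftBlk (fun b : Tor (fine (L ^ n * L ^ K) M) × Fin (d + 1) => blockOf (L ^ n * L ^ K) M b.1) ι)) (BlockNorm.ofBlocks (unitTorusGeo L K M) (liftBlk (blockOf (L ^ n * L ^ K) M) ι)) (Matrix.mulVecLin (cGreen M (L ^ n * L ^ K) (fun (_ : Fin (d + 1)) (_ : Tor (fine (L ^ n * L ^ K) M)) => (1 : Matrix ι ι ℝ)) (aK a₀ (L : ℝ) (n + K) * (((L ^ n * L ^ K) : ℕ) : ℝ) ^ (d + 1)) * (cgrad M (L ^ n * L ^ K) (fun (_ : Fin (d + 1)) (_ : Tor (fine (L ^ n * L ^ K) M)) => (1 : Matrix ι ι ℝ)))ᵀ)) (fun y y' => C * Real.exp (-(δ * tdistT M y y'))) ∧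
        HasMaj (BlockNorm.ofBlocks (unitTorusGeo L K M) (liftBlk (blockOf (L ^ n * L ^ K) M) ι)) (BlockNorm.ofBlocks (unitTorusGeo L K M) (liftBlk (fun b : Tor (fine (L ^ n * L ^ K) M) × Fin (d + 1) => blockOf (L ^ n * L ^ K) M b.1) ι)) (Matrix.mulVecLin ((bBack M (L ^ n * L ^ K) (ι := ι)) * ((cgrad M (L ^ n * L ^ K) (fun (_ : Fin (d + 1)) (_ : Tor (fine (L ^ n * L ^ K) M)) => (1 : Matrix ι ι ℝ))) * (cGreen M (L ^ n * L ^ K) (fun (_ : Fin (d + 1)) (_ : Tor (fine (L ^ n * L ^ K) M)) => (1 : Matrix ι ι ℝ)) (aK a₀ (L : ℝ) (n + K) * (((L ^ n * L ^ K) : ℕ) : ℝ) ^ (d + 1)))))) (fun y y' => C * Real.exp (-(δ * tdistT M y y'))) ∧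
        HasMaj (BlockNorm.ofBlocks (unitTorusGeo L K M) (liftBlk (blockOf (L ^ K) M) ι)) (BlockNorm.ofBlocks (unitTorusGeo L K M) (liftBlk (blockOf (L ^ n * L ^ K) M) ι)) (idef (pull (liftMap (kingPr L K n M) ι)) (pull (liftMap (kingPr L K n M) ι)) (Matrix.mulVecLin (cGreen M (L ^ n * L ^ K) (fun (_ : Fin (d + 1)) (_ : Tor (fine (L ^ n * L ^ K) M)) => (1 : Matrix ι ι ℝ)) (aK a₀ (L : ℝ) (n + K) * (((L ^ n * L ^ K) : ℕ) : ℝ) ^ (d + 1)))) (Matrix.mulVecLin (cGreen M (L ^ K) (fun (_ : Fin (d + 1)) (_ : Tor (fine (L ^ K) M)) => (1 : Matrix ι ι ℝ)) (aK a₀ (L : ℝ) K * (((L ^ K) : ℕ) : ℝ) ^ (d + 1))))) (fun y y' => C * ((L : ℝ) ^ K) ^ (-γ) * Real.exp (-(δ * tdistT M y y'))) ∧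
        HasMaj (BlockNorm.ofBlocks (unitTorusGeo L K M) (liftBlk (blockOf (L ^ K) M) ι)) (BlockNorm.ofBlocks (unitTorusGeo L K M) (liftBlk (fun b : Tor (fine (L ^ n * L ^ K) M) × Fin (d + 1) => blockOf (L ^ n * L ^ K) M b.1) ι)) (idef (pull (liftMap (kingPr L K n M) ι)) (pull (liftMap (kingPrV L K n M) ι)) (Matrix.mulVecLin (cgrad M (L ^ n * L ^ K) (fun (_ : Fin (d + 1)) (_ : Tor (fine (L ^ n * L ^ K) M)) => (1 : Matrix ι ι ℝ)) * cGreen M (L ^ n * L ^ K) (fun (_ : Fin (d + 1)) (_ : Tor (fine (L ^ n * L ^ K) M)) => (1 : Matrix ι ι ℝ)) (aK a₀ (L : ℝ) (n + K) * (((L ^ n * L ^ K) : ℕ) : ℝ) ^ (d + 1)))) (Matrix.mulVecLin (cgrad M (L ^ K) (fun (_ : Fin (d + 1)) (_ : Tor (fine (L ^ K) M)) => (1 : Matrix ι ι ℝ)) * cGreen M (L ^ K) (fun (_ : Fin (d + 1)) (_ : Tor (fine (L ^ K) M)) => (1 : Matrix ι ι ℝ)) (aK a₀ (L : ℝ) K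 * (((L ^ K) : ℕ) : ℝ) ^ (d + 1))))) (fun y y' => C * ((L : ℝ) ^ K) ^ (-γ) * Real.exp (-(δ * tdistT M y y'))) ∧
        HasMaj (BlockNorm.ofBlocks (unitTorusGeo L K M) (liftBlk (fun b : Tor (fine (L ^ K) M) × Fin (d + 1) => blockOf (L ^ K) M b.1) ι)) (BlockNorm.ofBlocks (unitTorusGeo L K M) (liftBlk (blockOf (L ^ n * L ^ K) M) ι)) (idef (pull (liftMap (kingPrV L K n M) ι)) (pull (liftMap (kingPr L K n M) ι)) (Matrix.mulVecLin (cGreen M (L ^ n * L ^ K) (fun (_ : Fin (d + 1)) (_ : Tor (fine (L ^ n * L ^ K) M)) => (1 : Matrix ι ι ℝ)) (aK a₀ (L : ℝ) (n + K) * (((L ^ n * L ^ K) : ℕ) : ℝ) ^ (d + 1)) * (cgrad M (L ^ n * L ^ K) (fun (_ : Fin (d + 1)) (_ : Tor (fine (L ^ n * L ^ K) M)) => (1 : Matrix ι ι ℝ)))ᵀ)) (Matrix.mulVecLin (cGreen M (L ^ K) (fun (_ : Fin (d + 1)) (_ : Tor (fine (L ^ K) M)) => (1 : Matrix ι ι ℝ))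 (aK a₀ (L : ℝ) K * (((L ^ K) : ℕ) : ℝ) ^ (d + 1)) * (cgrad M (L ^ K) (fun (_ : Fin (d + 1)) (_ : Tor (fine (L ^ K) M)) => (1 : Matrix ι ι ℝ)))ᵀ))) (fun y y' => C * ((L : ℝ) ^ K) ^ (-γ) * Real.exp (-(δ * tdistT M y y'))) ∧
        HasMaj (BlockNorm.ofBlocks (unitTorusGeo L K M) (liftBlk (blockOf (L ^ K) M) ι)) (BlockNorm.ofBlocks (unitTorusGeo L K M) (liftBlk (fun b : Tor (fine (L ^ n * L ^ K) M) × Fin (d + 1) => blockOf (L ^ n * L ^ K) M b.1) ι)) (idef (pull (liftMap (kingPr L K n M) ι)) (pull (liftMap (kingPrV L K n M) ι)) (Matrix.mulVecLin ((bBack M (L ^ n * L ^ K) (ι := ι)) * ((cgrad M (L ^ n * L ^ K) (fun (_ : Fin (d + 1)) (_ : Tor (fine (L ^ n * L ^ K) M)) => (1 : Matrix ι ι ℝ))) * (cGreen M (L ^ n * L ^ K) (fun (_ : Fin (d + 1)) (_ : Tor (fine (L ^ n * L ^ K) M)) => (1 : Matrix ι ι ℝ)) (aK a₀ (L : ℝ)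 (n + K) * (((L ^ n * L ^ K) : ℕ) : ℝ) ^ (d + 1)))))) (Matrix.mulVecLin ((bBack M (L ^ K) (ι := ι)) * ((cgrad M (L ^ K) (fun (_ : Fin (d + 1)) (_ : Tor (fine (L ^ K) M)) => (1 : Matrix ι ι ℝ))) * (cGreen M (L ^ K) (fun (_ : Fin (d + 1)) (_ : Tor (fine (L ^ K) M)) => (1 : Matrix ι ι ℝ)) (aK a₀ (L : ℝ) K * (((L ^ K) : ℕ) : ℝ) ^ (d + 1))))))) (fun y y' => C * ((L : ℝ) ^ K) ^ (-γ) * Real.exp (-(δ * tdistT M y y'))) := by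
  obtain ⟨C₁, δ₁, hC₁, hδ₁, H₁⟩ := flatKernelRows_king (d := d) L hLodd hL ha₀
  obtain ⟨C₂, δ₂, hC₂, hδ₂, H₂⟩ := flatKernelRow_gradBack_king (d := d) L hLodd hL ha₀
  obtain ⟨C₃, δ₃, hC₃, hδ₃, H₃⟩ := flatTwoGridKernelRows_king (d := d) L hLodd hL ha₀ hγ0.le hγ1
  obtain ⟨C₄, δ₄, hC₄, hδ₄, H₄⟩ := flatTwoGridRow_gradBack_king (d := d) L hLodd hL ha₀ hγ0 hγ1
  refine ⟨max (max C₁ C₂) (max C₃ C₄), min (min δ₁ δ₂) (min δ₃ δ₄), lt_max_of_lt_left (lt_max_of_lt_left hC₁), lt_min (lt_min hδ₁ hδ₂) (lt_min hδ₃ hδ₄), ?_⟩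
  intro K hK n hn e M _ hM ι _ _
  have hKn : 1 ≤ n + K := hK.trans (Nat.le_add_left K n)
  have hpow : L ^ n * L ^ K = L ^ (n + K) := (pow_add L n K).symm
  obtain ⟨hGc, hDc, hAc⟩ := H₁ K hK (L ^ K) rfl e M hM K ι
  obtain ⟨hGf, hDf, hAf⟩ := H₁ (n + K) hKn (L ^ n * L ^ K) hpow e M hM K ι
  have hBc := H₂ K hK (L ^ K) rfl e M hM K ι
  have hBf := H₂ (n + K) hKn (L ^ n * L ^ K) hpow e M hM K ι
  obtain ⟨hTG, hTD, hTA⟩ := H₃ K hK n hn e M hM K ι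
  have hTB := H₄ K hK n hn e M hM ι
  -- constants
  have hCpos : 0 ≤ max (max C₁ C₂) (max C₃ C₄) := (hC₁.le.trans (le_max_left _ _)).trans (le_max_left _ _)
  have hθ : 0 ≤ ((L : ℝ) ^ K) ^ (-γ) := Real.rpow_nonneg (pow_nonneg (Nat.cast_nonneg L) K) _
  have hm1 : ∀ (c δ' : ℝ) (y y' : Tor M), c ≤ max (max C₁ C₂) (max C₃ C₄) → min (min δ₁ δ₂) (min δ₃ δ₄) ≤ δ' →
      c * Real.exp (-(δ' * tdistT M y y')) ≤ max (max C₁ C₂) (max C₃ C₄) * Real.exp (-(min (min δ₁ δ₂) (min δ₃ δ₄) * tdistT M y y')) :=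
    fun c δ' y y' hc hδ' => mul_le_mul hc (Real.exp_le_exp.mpr (by nlinarith [tdistT_nonneg M y y'])) (Real.exp_nonneg _) hCpos
  have hm2 : ∀ (c δ' : ℝ) (y y' : Tor M), c ≤ max (max C₁ C₂) (max C₃ C₄) → min (min δ₁ δ₂) (min δ₃ δ₄) ≤ δ' →
      c * ((L : ℝ) ^ K) ^ (-γ) * Real.exp (-(δ' * tdistT M y y')) ≤ max (max C₁ C₂) (max C₃ C₄) * ((L : ℝ) ^ K) ^ (-γ) * Real.exp (-(min (min δ₁ δ₂) (min δ₃ δ₄) * tdistT M y y')) :=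
    fun c δ' y y' hc hδ' => mul_le_mul (mul_le_mul_of_nonneg_right hc hθ) (Real.exp_le_exp.mpr (by nlinarith [tdistT_nonneg M y y'])) (Real.exp_nonneg _) (mul_nonneg hCpos hθ)
  have h1 : C₁ ≤ max (max C₁ C₂) (max C₃ C₄) := (le_max_left _ _).trans (le_max_left _ _)
  have h2 : C₂ ≤ max (max C₁ C₂) (max C₃ C₄) := (le_max_right _ _).trans (le_max_left _ _)
  have h3 : C₃ ≤ max (max C₁ C₂) (max C₃ C₄) := (le_max_left _ _).trans (le_max_right _ _)
  have h4 : C₄ ≤ max (max C₁ C₂) (max C₃ C₄) := (le_max_right _ _).trans (le_max_right _ _)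
  have e1 : min (min δ₁ δ₂) (min δ₃ δ₄) ≤ δ₁ := (min_le_left _ _).trans (min_le_left _ _)
  have e2 : min (min δ₁ δ₂) (min δ₃ δ₄) ≤ δ₂ := (min_le_left _ _).trans (min_le_right _ _)
  have e3 : min (min δ₁ δ₂) (min δ₃ δ₄) ≤ δ₃ := (min_le_right _ _).trans (min_le_left _ _)
  have e4 : min (min δ₁ δ₂) (min δ₃ δ₄) ≤ δ₄ := (min_le_right _ _).trans (min_le_right _ _)
  exact ⟨hGc.mono fun y y' => hm1 C₁ δ₁ y y' h1 e1, hDc.mono fun y y' => hm1 C₁ δ₁ y y' h1 e1, hAc.mono fun y y' => hm1 C₁ δ₁ y y' h1 e1, hBc.mono fun y y' => hm1 C₂ δ₂ y y' h2 e2,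
    hGf.mono fun y y' => hm1 C₁ δ₁ y y' h1 e1, hDf.mono fun y y' => hm1 C₁ δ₁ y y' h1 e1, hAf.mono fun y y' => hm1 C₁ δ₁ y y' h1 e1, hBf.mono fun y y' => hm1 C₂ δ₂ y y' h2 e2,
    hTG.mono fun y y' => hm2 C₃ δ₃ y y' h3 e3, hTD.mono fun y y' => hm2 C₃ δ₃ y y' h3 e3, hTA.mono fun y y' => hm2 C₃ δ₃ y y' h3 e3, hTB.mono fun y y' => hm2 C₄ δ₄ y y' h4 e4⟩

end Summit.QuantumFields.YangMills.BalabanUVNodes.N15.CovLandau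

end
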